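import Mathlib
import Summits.ValiantsHypothesis.ValiantsHypothesis.Theorems.LiouvilleSarnakAlignedTypeIOfDigitalBilinear
import Summits.ValiantsHypothesis.ValiantsHypothesis.Theorems.LiouvilleSarnakAlignedTypeITransposedHolds

/-!
# Route LiouvilleSarnak — crux `DigitalBilinearLiouville` (stmt-ValiantsHypothesis-14774) in rectangle
# currency: FULL ROWS × ANY COLUMNS for EVERY cut whose lowest digits are row digits (unconditional)

`Theorems/LiouvilleSarnakDigitalBilinearLiouvilleRectangles.lean`: the crux ⟺ `λ` has discrepancy
`o(4^n)` on every digital combinatorial rectangle `A ×_π B`.  `…RectanglesAligned.lean` proved the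
one-sided family `univ × B` on the ALIGNED cut from Matomäki–Radziwiłł.  This file proves that family
for EVERY balanced cut whose lowest `L` bit positions are row positions, with `L = L(ε)` a constant:

* ★ `rectangles_fullRows_of_lowRows`: for every `ε > 0` there is `L` such that for all `n`, every cut
  `π` of the `2n` positions whose positions `0, …, L-1` are row bits, and every set `B ⊆ {0,1}^n` of
  column digit strings, `|Σ_{r} Σ_{c ∈ B} λ(N_π(r, c) + 1)| ≤ ε · 4^n`.

Mechanism: for fixed column digits `c` and fixed HIGH row digits, the `2^L` settings of the low row
digits sweep an aligned interval `[2^L b + 1, 2^L (b + 1)]` (§1: the rows split as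
`{high part} × {0,1}^L`, an explicit `Equiv`; the cut number is `2^L b + ofBits(low)`), distinct
`(high rows, c)` give distinct blocks `b < 2^{2n-L}` (§2), and
`Σ_{b < 2^{2n-L}} |Σ_{a<2^L} λ(a + 2^L b + 1)| ≤ ε 2^L 2^{2n-L}` is Matomäki–Radziwiłł in almost all
short intervals (tree: `AlignedTypeI.Transposed.sum_abs_blockSum_le`).  In words: `λ` cancels along
almost every digital ROW FIBRE as soon as the rows own the lowest `L(ε)` digits — whatever the other
`2n - L` positions do.  (The symmetric statement for columns owning the low digits is the family
`A × univ` by transposition of roles; not restated.)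

Honest framing: an unconditional one-sided rung for a `2^{-L(ε)}` fraction of all cuts; the two-sided
rectangle statement (the crux), `LiouvilleCutRank`, `AlignedTypeI` (rows own the low digits but the sum
is over `A × univ`) and `AlgebraicSarnak` stay OPEN, and nothing here bears on VP versus VNP.
No definitions. [cite: MatomakiRadziwillAnnals2016, Theorem 1]
-/

-- the directory `ValiantsHypothesis/ValiantsHypothesis` repeats the summit name (tree layout)
set_option linter.dupNamespace false

namespace Summit.ValiantsHypothesis.ValiantsHypothesis.Theorems.LiouvilleSarnakDigitalBilinearLiouville.Rectangles

open Finset ArithmeticFunction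

open Summit.ValiantsHypothesis.ValiantsHypothesis.Theorems.LiouvilleSarnak.AlignedTypeI.CharactersModTwoN
  (sum_boolVec_eq_sum_fin ofBits_injective_boolVec)
open Summit.ValiantsHypothesis.ValiantsHypothesis.Theorems.LiouvilleSarnak.AlignedTypeI.Transposed
  (sum_abs_blockSum_le)

/-! ### §1 Splitting the rows into low digits and the rest -/

/-- The cut number is injective in the pair (row digits, column digits). [folklore] -/
theorem cutNumber_injective (n : ℕ) (π : Fin n ⊕ Fin n ≃ Fin (2 * n)) (r r' c c' : Fin n → Bool)
    (h : Nat.ofBits (fun j : Fin (2 * n) => Sum.elim r c (π.symm j)) =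
      Nat.ofBits (fun j : Fin (2 * n) => Sum.elim r' c' (π.symm j))) : r = r' ∧ c = c' := by
  have hfun := ofBits_injective_boolVec (2 * n) h
  constructor
  · funext i
    have := congrFun hfun (π (Sum.inl i))
    simpa using this
  · funext i
    have := congrFun hfun (π (Sum.inr i))
    simpa using this

/-- **Low digits of the cut number.**  If the positions `< L` are row positions and the row vector
takes the value `t ⟨π(inl i), _⟩` at every row index `i` of position `< L`, then bit `j < L` of the
cut number is `t j`; bits `≥ L` do not depend on the low row digits. [folklore] -/
theorem testBit_cutNumber (n : ℕ) (π : Fin n ⊕ Fin n ≃ Fin (2 * n)) (r : Fin n → Bool)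
    (c : Fin n → Bool) (j : ℕ) (hj : j < 2 * n) :
    (Nat.ofBits (fun j : Fin (2 * n) => Sum.elim r c (π.symm j))).testBit j =
      Sum.elim r c (π.symm ⟨j, hj⟩) := by
  rw [Nat.testBit_ofBits_lt _ _ hj]

/-- ★ **Full rows × any columns, for every cut whose lowest `L(ε)` positions are row bits.**  For every
`ε > 0` there is `L` such that for every `n`, every balanced cut `π` of the `2n` bit positions with
`(π.symm j).isLeft` for all `j < L` (and `L ≤ 2n`), and every set `B` of column digit strings,
`|Σ_{r} Σ_{c ∈ B} λ(N_π(r, c) + 1)| ≤ ε · 4^n`: each row fibre is a union of aligned intervals of length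
`2^L`, over which `λ` cancels on average (Matomäki–Radziwiłł).
[cite: MatomakiRadziwillAnnals2016, Theorem 1] -/
theorem rectangles_fullRows_of_lowRows :
    ∀ ε : ℝ, 0 < ε → ∃ L : ℕ, ∀ n : ℕ, ∀ π : Fin n ⊕ Fin n ≃ Fin (2 * n), L ≤ 2 * n →
      (∀ j : Fin (2 * n), (j : ℕ) < L → (π.symm j).isLeft = true) →
      ∀ B : Finset (Fin n → Bool),
        |∑ r : Fin n → Bool, ∑ c ∈ B, ((liouville
          (Nat.ofBits (fun j : Fin (2 * n) => Sum.elim r c (π.symm j)) + 1) : ℤ) : ℝ)| ≤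
          ε * 4 ^ n := by
  classical
  intro ε hε
  obtain ⟨h₀, hh₀⟩ := sum_abs_blockSum_le hε
  refine ⟨h₀, fun n π hLn hrow B => ?_⟩
  set L : ℕ := h₀ with hL
  -- notation
  set N : (Fin n → Bool) → (Fin n → Bool) → ℕ := fun r c =>
    Nat.ofBits (fun j : Fin (2 * n) => Sum.elim r c (π.symm j)) with hN
  -- the row index sitting at a low position
  have hlow : ∀ j : Fin L, ∃ i : Fin n, π.symm ⟨j, by omega⟩ = Sum.inl i := fun j =>
    Sum.isLeft_iff.mp (hrow ⟨j, by omega⟩ j.isLt)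
  choose ρ hρ using hlow
  have hπρ : ∀ j : Fin L, π (Sum.inl (ρ j)) = ⟨j, by omega⟩ := fun j => by
    rw [← hρ j, Equiv.apply_symm_apply]
  have hρ_of_low : ∀ (i : Fin n) (h : (π (Sum.inl i) : ℕ) < L), ρ ⟨π (Sum.inl i), h⟩ = i := by
    intro i h
    have h1 := hπρ ⟨π (Sum.inl i), h⟩
    have h2 : (⟨(π (Sum.inl i) : ℕ), by omega⟩ : Fin (2 * n)) = π (Sum.inl i) := Fin.ext rfl
    rw [h2] at h1
    exact Sum.inl_injective (π.injective h1)
  -- the split `rows ≃ high part × low digits`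
  let U := {i : Fin n // ¬ (π (Sum.inl i) : ℕ) < L}
  let glue : (U → Bool) → (Fin L → Bool) → (Fin n → Bool) := fun u t i =>
    if h : (π (Sum.inl i) : ℕ) < L then t ⟨π (Sum.inl i), h⟩ else u ⟨i, h⟩
  let Φ : (Fin n → Bool) ≃ (U → Bool) × (Fin L → Bool) :=
    { toFun := fun r => (fun i => r i.1, fun j => r (ρ j))
      invFun := fun p => glue p.1 p.2
      left_inv := by
        intro r
        funext i
        simp only [glue]
        split_ifs with h
        · rw [hρ_of_low i h]
        · rfl
      right_inv := by
        rintro ⟨u, t⟩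
        simp only [glue, Prod.mk.injEq]
        constructor
        · funext i
          rw [dif_neg i.2]
        · funext j
          have h : (π (Sum.inl (ρ j)) : ℕ) < L := by rw [hπρ j]; exact j.isLt
          rw [dif_pos h]
          congr 1
          exact Fin.ext (by simp [hπρ j]) }
  -- bits of the glued number: low bits are `t`, high bits do not see `t`
  have hbit_low : ∀ (u : U → Bool) (t : Fin L → Bool) (c : Fin n → Bool) (j : ℕ) (hj : j < L),
      (N (glue u t) c).testBit j = t ⟨j, hj⟩ := by
    intro u t c j hj
    rw [hN]
    simp only
    rw [testBit_cutNumber n π _ c j (by omega), hρ ⟨j, hj⟩, Sum.elim_inl]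
    simp only [glue]
    have h : (π (Sum.inl (ρ ⟨j, hj⟩)) : ℕ) < L := by rw [hπρ]; exact hj
    rw [dif_pos h]
    congr 1
    exact Fin.ext (by simp [hπρ])
  have hbit_high : ∀ (u : U → Bool) (t t' : Fin L → Bool) (c : Fin n → Bool) (j : ℕ), L ≤ j →
      (N (glue u t) c).testBit j = (N (glue u t') c).testBit j := by
    intro u t t' c j hj
    by_cases hj2 : j < 2 * n
    · rw [hN]
      simp only
      rw [testBit_cutNumber n π _ c j hj2, testBit_cutNumber n π _ c j hj2]
      rcases hq : π.symm ⟨j, hj2⟩ with i | i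
      · simp only [Sum.elim_inl, glue]
        have hi : ¬ (π (Sum.inl i) : ℕ) < L := by
          have : π (Sum.inl i) = ⟨j, hj2⟩ := by rw [← hq, Equiv.apply_symm_apply]
          rw [this]; exact not_lt.mpr hj
        rw [dif_neg hi, dif_neg hi]
      · simp only [Sum.elim_inr]
    · rw [hN]
      simp only
      rw [Nat.testBit_ofBits_ge _ _ (not_lt.mp hj2), Nat.testBit_ofBits_ge _ _ (not_lt.mp hj2)]
  -- the block index of `(u, c)` and the decomposition `N = 2^L b + ofBits t`
  set b : (U → Bool) → (Fin n → Bool) → ℕ := fun u c => N (glue u (fun _ => false)) c / 2 ^ L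
    with hb
  have hdecomp : ∀ (u : U → Bool) (t : Fin L → Bool) (c : Fin n → Bool),
      N (glue u t) c = 2 ^ L * b u c + Nat.ofBits t := by
    intro u t c
    apply Nat.eq_of_testBit_eq
    intro j
    rw [Nat.testBit_two_pow_mul_add _ (Nat.ofBits_lt_two_pow t)]
    by_cases hj : j < L
    · rw [if_pos hj, hbit_low u t c j hj, Nat.testBit_ofBits_lt _ _ hj]
    · rw [if_neg hj, hb]
      simp only
      rw [Nat.testBit_div_two_pow, show j - L + L = j by omega,
        hbit_high u t (fun _ => false) c j (not_lt.mp hj)]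
  -- the row fibre sum over the low digits is a block sum
  have hfibre : ∀ (u : U → Bool) (c : Fin n → Bool),
      ∑ t : Fin L → Bool, ((liouville (N (glue u t) c + 1) : ℤ) : ℝ) =
        ∑ a ∈ range (2 ^ L), ((liouville (a + 2 ^ L * b u c + 1) : ℤ) : ℝ) := by
    intro u c
    simp_rw [hdecomp]
    rw [← Fin.sum_univ_eq_sum_range]
    have := sum_boolVec_eq_sum_fin L (fun x => ((liouville (x + 2 ^ L * b u c + 1) : ℤ) : ℝ))
    rw [← this]
    refine Finset.sum_congr rfl fun t _ => ?_
    rw [Nat.add_comm (2 ^ L * b u c)]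
  -- `(u, c) ↦ b u c` is injective, with values `< 2^{2n-L}`
  have hb_inj : ∀ u u' c c', b u c = b u' c' → u = u' ∧ c = c' := by
    intro u u' c c' h
    have h1 : N (glue u (fun _ => false)) c = N (glue u' (fun _ => false)) c' := by
      have e1 := hdecomp u (fun _ => false) c
      have e2 := hdecomp u' (fun _ => false) c'
      rw [h] at e1
      omega
    have h2 := cutNumber_injective n π _ _ c c' h1
    refine ⟨?_, h2.2⟩
    have h3 := congrArg Φ h2.1
    have h4 : Φ (glue u (fun _ => false)) = (u, fun _ => false) :=
      Φ.apply_symm_apply (u, fun _ => false)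
    have h5 : Φ (glue u' (fun _ => false)) = (u', fun _ => false) :=
      Φ.apply_symm_apply (u', fun _ => false)
    rw [h4, h5] at h3
    exact (Prod.mk.injEq _ _ _ _).mp h3 |>.1
  have hb_lt : ∀ u c, b u c < 2 ^ (2 * n - L) := by
    intro u c
    rw [hb]
    simp only
    rw [Nat.div_lt_iff_lt_mul (Nat.two_pow_pos L), ← pow_add, show 2 * n - L + L = 2 * n by omega]
    exact Nat.ofBits_lt_two_pow _
  -- the estimate
  have hS_nonneg : ∀ x : ℕ, 0 ≤ |∑ a ∈ range (2 ^ L), ((liouville (a + 2 ^ L * x + 1) : ℤ) : ℝ)| :=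
    fun x => abs_nonneg _
  calc |∑ r : Fin n → Bool, ∑ c ∈ B, ((liouville (N r c + 1) : ℤ) : ℝ)|
      = |∑ c ∈ B, ∑ r : Fin n → Bool, ((liouville (N r c + 1) : ℤ) : ℝ)| := by rw [Finset.sum_comm]
    _ = |∑ c ∈ B, ∑ u : U → Bool, ∑ t : Fin L → Bool,
          ((liouville (N (glue u t) c + 1) : ℤ) : ℝ)| := by
        congr 1
        refine Finset.sum_congr rfl fun c _ => ?_
        rw [← Fintype.sum_prod_type']
        exact Fintype.sum_equiv Φ _ _ (fun r => by
          have hr : glue (Φ r).1 (Φ r).2 = r := Φ.symm_apply_apply r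
          simp only [hr])
    _ = |∑ c ∈ B, ∑ u : U → Bool,
          ∑ a ∈ range (2 ^ L), ((liouville (a + 2 ^ L * b u c + 1) : ℤ) : ℝ)| := by
        simp_rw [hfibre]
    _ ≤ ∑ c ∈ B, ∑ u : U → Bool,
          |∑ a ∈ range (2 ^ L), ((liouville (a + 2 ^ L * b u c + 1) : ℤ) : ℝ)| := by
        refine (Finset.abs_sum_le_sum_abs _ _).trans (Finset.sum_le_sum fun c _ => ?_)
        exact Finset.abs_sum_le_sum_abs _ _
    _ ≤ ∑ c : Fin n → Bool, ∑ u : U → Bool,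
          |∑ a ∈ range (2 ^ L), ((liouville (a + 2 ^ L * b u c + 1) : ℤ) : ℝ)| :=
        Finset.sum_le_univ_sum_of_nonneg fun c => Finset.sum_nonneg fun u _ => abs_nonneg _
    _ = ∑ p : (Fin n → Bool) × (U → Bool),
          |∑ a ∈ range (2 ^ L), ((liouville (a + 2 ^ L * b p.2 p.1 + 1) : ℤ) : ℝ)| := by
        rw [Fintype.sum_prod_type]
    _ = ∑ x ∈ Finset.univ.image (fun p : (Fin n → Bool) × (U → Bool) => b p.2 p.1),
          |∑ a ∈ range (2 ^ L), ((liouville (a + 2 ^ L * x + 1) : ℤ) : ℝ)| := by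
        rw [Finset.sum_image]
        rintro ⟨c, u⟩ - ⟨c', u'⟩ - h
        obtain ⟨hu, hc⟩ := hb_inj u u' c c' h
        rw [hu, hc]
    _ ≤ ∑ x ∈ range (2 ^ (2 * n - L)),
          |∑ a ∈ range (2 ^ L), ((liouville (a + 2 ^ L * x + 1) : ℤ) : ℝ)| := by
        refine Finset.sum_le_sum_of_subset_of_nonneg ?_ (fun x _ _ => hS_nonneg x)
        intro x hx
        obtain ⟨p, -, rfl⟩ := Finset.mem_image.mp hx
        exact Finset.mem_range.mpr (hb_lt p.2 p.1)
    _ ≤ ε * 2 ^ L * (2 ^ (2 * n - L) : ℕ) := by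
        have := hh₀ (2 ^ L) (Nat.lt_two_pow_self).le (2 ^ (2 * n - L))
        push_cast at this ⊢
        convert this using 3
    _ = ε * 4 ^ n := by
        push_cast
        rw [mul_assoc, ← pow_add, show L + (2 * n - L) = 2 * n by omega, pow_mul]
        norm_num

end Summit.ValiantsHypothesis.ValiantsHypothesis.Theorems.LiouvilleSarnakDigitalBilinearLiouville.Rectangles
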